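import Mathlib
import Summits.ABC.ABC.Theorems.SoloInformedTheoremBCore
import Summits.ABC.ABC.Theorems.SoloInformedOnePrimeSubgroup
import Summits.ABC.ABC.Theorems.SoloInformedOnePrimeGrowingIndex

/-!
# Solo (informed) — Theorem B and the subgroup two-logarithm bound from Theorem A

Assuming Theorem A (the hypothesis `hA`, see `SoloInformedTheoremBCore`):
* **Theorem B** (`soloInformed_theoremB_of_theoremA`): for an odd prime `p`, odd coprime
  `u ≠ v` prime to `p`, any `g ≥ |⟨2, u/v⟩ ⊂ (ℤ/p)ˣ|`, `a₁ log p ≥ log(2 max(u,v))`,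
  `a₂ log p ≥ log max(u,v)`:  `W(p) = v_p(2^{p-1}-1) ≤ max{100·g·a₁a₂, 250} + 4`;
* **Corollary** (`soloInformed_subgroupTwoLogBound_of_theoremA`): the hypothesis `hH` of
  `soloInformed_wieferichExp_le_of_subgroupTwoLogBound` /
  `soloInformed_onePrime_growingIndex_of_subgroupTwoLogBound` with `C = 100`, `C' = 254`.
* `soloInformed_theoremC_of_theoremA`, `soloInformed_corollaryD_of_theoremA`: Theorem C and
  Corollary D of the report (solo-ABC-informed, paper §2.3) as consequences of Theorem A alone;
  the only non-kernel input left in §2.3 is Theorem A itself.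
-/

namespace Summit.ABC.ABC.Theorems

open Finset

section TheoremA

/- Theorem A as an explicit hypothesis (see `SoloInformedTheoremBCore`). -/
variable (hA : ∀ (p : ℕ) [Fact p.Prime], 5 ≤ p →
  ∀ (α₁ α₂ : ℚ), α₁ ≠ 0 → α₂ ≠ 0 → padicValRat p α₁ = 0 → padicValRat p α₂ = 0 →
  (∀ m n : ℤ, α₁ ^ m * α₂ ^ n = 1 → m = 0 ∧ n = 0) →
  ∀ (h₁ h₂ : ℝ), Real.log (max (α₁.num.natAbs : ℝ) (α₁.den : ℝ)) ≤ h₁ →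
    Real.log (max (α₂.num.natAbs : ℝ) (α₂.den : ℝ)) ≤ h₂ →
  ∀ (K L R₁ R₂ S₁ S₂ b₁ b₂ : ℕ), 3 ≤ K → 2 ≤ L → 1 ≤ R₁ → 1 ≤ R₂ → 1 ≤ S₁ → 1 ≤ S₂ →
    1 ≤ b₁ → 1 ≤ b₂ → ¬ p ∣ b₁ →
  (1 : ℝ) ≤ (((R₁ : ℝ) + R₂ - 2) * b₂ + ((S₁ : ℝ) + S₂ - 2) * b₁) / 2
      * (∏ k ∈ Finset.range K, (k.factorial : ℝ)) ^ (-(2 : ℝ) / ((K : ℝ) ^ 2 - K)) →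
  (∃ κ : ZMod p, L ≤ (((Finset.range R₁ ×ˢ Finset.range S₁).filter
      (fun rs : ℕ × ℕ => (α₁ : ZMod p) ^ rs.1 * (α₂ : ZMod p) ^ rs.2 = κ)).image
      (fun rs : ℕ × ℕ => α₁ ^ rs.1 * α₂ ^ rs.2)).card) →
  (∃ κ : ZMod p, (K - 1) * L < (((Finset.range R₂ ×ˢ Finset.range S₂).filter
      (fun rs : ℕ × ℕ => (α₁ : ZMod p) ^ rs.1 * (α₂ : ZMod p) ^ rs.2 = κ)).image
      (fun rs : ℕ × ℕ => rs.1 * b₂ + rs.2 * b₁)).card) →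
  3 * Real.log ((K : ℝ) * L)
    + ((K : ℝ) - 1) * Real.log ((((R₁ : ℝ) + R₂ - 2) * b₂ + ((S₁ : ℝ) + S₂ - 2) * b₁) / 2
        * (∏ k ∈ Finset.range K, (k.factorial : ℝ)) ^ (-(2 : ℝ) / ((K : ℝ) ^ 2 - K)))
    + (L : ℝ) / 2 * (((R₁ : ℝ) + R₂ - 2) * h₁ + ((S₁ : ℝ) + S₂ - 2) * h₂)
    < (K : ℝ) * (L - 1) * Real.log p →
  (padicValRat p (α₁ ^ b₁ - α₂ ^ b₂) : ℝ) ≤ (K : ℝ) * L - 1 / 2)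

include hA

/-- **Theorem B** (report §2.3): for an odd prime `p`, odd coprime `u ≠ v` prime to `p`, any
`g ≥ |⟨2, u/v⟩|` and `a₁ log p ≥ log(2 max(u,v))`, `a₂ log p ≥ log max(u,v)`:
`W(p) ≤ max{100·g·a₁a₂, 250} + 4` — *assuming Theorem A*. -/
theorem soloInformed_theoremB_of_theoremA {p : ℕ} (hp : p.Prime) (hp2 : p ≠ 2) {u v : ℕ}
    (hu : Odd u) (hv : Odd v) (huv : u ≠ v) (hcop : Nat.Coprime u v)
    (hpu : ¬ p ∣ u) (hpv : ¬ p ∣ v) (u₂ uy : (ZMod p)ˣ) (hu₂ : (u₂ : ZMod p) = 2)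
    (huy : (uy : ZMod p) * v = u) {g : ℕ}
    (hg : Nat.card (Subgroup.closure ({u₂, uy} : Set (ZMod p)ˣ)) ≤ g)
    {a₁ a₂ : ℝ} (ha₁ : Real.log ((2 * max u v : ℕ) : ℝ) ≤ a₁ * Real.log p)
    (ha₂ : Real.log ((max u v : ℕ) : ℝ) ≤ a₂ * Real.log p) :
    (padicValNat p (2 ^ (p - 1) - 1) : ℝ) ≤ max (100 * ((g : ℝ) * a₁ * a₂)) 250 + 4 := by
  by_cases hG : 5 / 2 ≤ (g : ℝ) * a₁ * a₂
  · have := soloInformed_theoremB_core hA hp hp2 hu hv huv hcop hpu hpv u₂ uy hu₂ huy hg ha₁ ha₂ hG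
    linarith [le_max_left (100 * ((g : ℝ) * a₁ * a₂)) 250]
  · push Not at hG
    haveI : Fact p.Prime := ⟨hp⟩
    -- positivity of log p, a₂, g
    have hp3r : (3 : ℝ) ≤ p := by
      have : 3 ≤ p := by have := hp.two_le; omega
      exact_mod_cast this
    have hLp0 : 0 < Real.log p := Real.log_pos (by linarith)
    have hmax3 : (3 : ℝ) ≤ ((max u v : ℕ) : ℝ) := by
      have : 3 ≤ max u v := by obtain ⟨a, rfl⟩ := hu; obtain ⟨b, rfl⟩ := hv; omega
      exact_mod_cast this
    have hlogmax : 0 < Real.log ((max u v : ℕ) : ℝ) := Real.log_pos (by linarith)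
    have ha₂0 : 0 < a₂ := by
      by_contra h; push Not at h; nlinarith
    have hg0 : (0 : ℝ) < g := by
      have : 0 < Nat.card (Subgroup.closure ({u₂, uy} : Set (ZMod p)ˣ)) := Nat.card_pos
      exact_mod_cast lt_of_lt_of_le this hg
    -- inflate a₁ to a₁' with g a₁' a₂ = 5/2
    set a₁' : ℝ := 5 / (2 * (g * a₂)) with ha₁'def
    have hga : 0 < (g : ℝ) * a₂ := mul_pos hg0 ha₂0
    have hG' : (g : ℝ) * a₁' * a₂ = 5 / 2 := by rw [ha₁'def]; field_simp
    have ha₁le : a₁ ≤ a₁' := by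
      rw [ha₁'def, le_div_iff₀ (by positivity)]; nlinarith
    have ha₁'' : Real.log ((2 * max u v : ℕ) : ℝ) ≤ a₁' * Real.log p :=
      ha₁.trans (mul_le_mul_of_nonneg_right ha₁le hLp0.le)
    have := soloInformed_theoremB_core hA hp hp2 hu hv huv hcop hpu hpv u₂ uy hu₂ huy hg ha₁'' ha₂
      hG'.symm.le
    rw [hG'] at this
    linarith [le_max_right (100 * ((g : ℝ) * a₁ * a₂)) 250]

/-- **Corollary.** Theorem A implies the subgroup-restricted two-logarithm bound `hH` of
`soloInformed_wieferichExp_le_of_subgroupTwoLogBound` with `C = 100`, `C' = 254`: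
for `u/v ∈ ⟨2⟩ (mod p)`, `W(p) ≤ 100·ord_p(2)·log(max u v)·log(2 max u v)/(log p)² + 254`.
Hence Theorem C and Corollary D of the report follow from Theorem A in the kernel. -/
theorem soloInformed_subgroupTwoLogBound_of_theoremA :
    ∀ p : ℕ, p.Prime → p ≠ 2 → ∀ u v k : ℕ, 0 < u → 0 < v → u ≠ v → Odd u → Odd v →
      ¬ p ∣ u → ¬ p ∣ v → (2 : ZMod p) ^ k * (v : ZMod p) = (u : ZMod p) →
      (padicValNat p (2 ^ (p - 1) - 1) : ℝ) ≤
        100 * orderOf (2 : ZMod p) * Real.log ((max u v : ℕ) : ℝ)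
          * Real.log (2 * ((max u v : ℕ) : ℝ)) / (Real.log p) ^ 2 + 254 := by
  intro p hp hp2 u v k hu0 hv0 huv hu hv hpu hpv hk
  classical
  haveI : Fact p.Prime := ⟨hp⟩
  -- reduce to lowest terms
  set d := Nat.gcd u v with hd
  have hd0 : 0 < d := Nat.gcd_pos_of_pos_left v hu0
  set u' := u / d with hu'
  set v' := v / d with hv'
  have huu : u' * d = u := Nat.div_mul_cancel (Nat.gcd_dvd_left u v)
  have hvv : v' * d = v := Nat.div_mul_cancel (Nat.gcd_dvd_right u v)
  have hcop : Nat.Coprime u' v' := Nat.coprime_div_gcd_div_gcd hd0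
  have hu'odd : Odd u' := (Nat.odd_mul.mp (huu.symm ▸ hu)).1
  have hv'odd : Odd v' := (Nat.odd_mul.mp (hvv.symm ▸ hv)).1
  have hu'v' : u' ≠ v' := by
    intro h; apply huv; rw [← huu, ← hvv, h]
  have hpu' : ¬ p ∣ u' := fun h => hpu (h.trans (Nat.div_dvd_of_dvd (Nat.gcd_dvd_left u v)))
  have hpv' : ¬ p ∣ v' := fun h => hpv (h.trans (Nat.div_dvd_of_dvd (Nat.gcd_dvd_right u v)))
  have hpd : ¬ p ∣ d := fun h => hpu (h.trans (Nat.gcd_dvd_left u v))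
  have hdZ : (d : ZMod p) ≠ 0 := fun h => hpd ((ZMod.natCast_eq_zero_iff d p).mp h)
  have hu'Z : (u' : ZMod p) ≠ 0 := fun h => hpu' ((ZMod.natCast_eq_zero_iff u' p).mp h)
  have hv'Z : (v' : ZMod p) ≠ 0 := fun h => hpv' ((ZMod.natCast_eq_zero_iff v' p).mp h)
  have hk' : (2 : ZMod p) ^ k * (v' : ZMod p) = (u' : ZMod p) := by
    have hv1 : ((v : ℕ) : ZMod p) = (v' : ZMod p) * (d : ZMod p) := by rw [← hvv, Nat.cast_mul]
    have hu1 : ((u : ℕ) : ZMod p) = (u' : ZMod p) * (d : ZMod p) := by rw [← huu, Nat.cast_mul]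
    have h1 : (2 : ZMod p) ^ k * (v' : ZMod p) * d = (u' : ZMod p) * d := by
      rw [mul_assoc, ← hv1, ← hu1]; exact hk
    exact mul_right_cancel₀ hdZ h1
  have h2ne0 : (2 : ZMod p) ≠ 0 := by
    intro h
    have : p ∣ 2 := (ZMod.natCast_eq_zero_iff 2 p).mp (by exact_mod_cast h)
    exact hp2 ((Nat.prime_dvd_prime_iff_eq hp Nat.prime_two).mp this)
  set u₂ : (ZMod p)ˣ := Units.mk0 (2 : ZMod p) h2ne0 with hu₂def
  set uy : (ZMod p)ˣ := Units.mk0 ((u' : ZMod p) / (v' : ZMod p)) (div_ne_zero hu'Z hv'Z)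
    with huydef
  have hu₂ : (u₂ : ZMod p) = 2 := rfl
  have huy : (uy : ZMod p) * v' = u' := by
    rw [huydef, Units.val_mk0, div_mul_cancel₀ _ hv'Z]
  -- uy = u₂^k, so |⟨u₂, uy⟩| ≤ ord u₂ = ord_p 2
  have huyk : uy = u₂ ^ k := by
    ext; rw [Units.val_pow_eq_pow_val, huydef, hu₂def, Units.val_mk0, Units.val_mk0,
      div_eq_iff hv'Z, hk']
  have hcl : Subgroup.closure ({u₂, uy} : Set (ZMod p)ˣ) ≤ Subgroup.zpowers u₂ := by
    rw [Subgroup.closure_le]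
    intro x hx
    simp only [Set.mem_insert_iff, Set.mem_singleton_iff] at hx
    rcases hx with rfl | rfl
    · exact Subgroup.mem_zpowers _
    · rw [huyk]; exact Subgroup.pow_mem _ (Subgroup.mem_zpowers _) k
  have hg : Nat.card (Subgroup.closure ({u₂, uy} : Set (ZMod p)ˣ)) ≤ orderOf (2 : ZMod p) := by
    have h1 := Subgroup.card_le_of_le hcl
    rw [Nat.card_zpowers, ← orderOf_units, hu₂] at h1
    exact h1
  -- heights
  have hp1 : (1 : ℝ) < p := by exact_mod_cast hp.one_lt
  have hLp0 : 0 < Real.log p := Real.log_pos hp1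
  have hmax : max u' v' ≤ max u v :=
    max_le_max (Nat.div_le_self u d) (Nat.div_le_self v d)
  have hmaxpos : 0 < max u' v' := lt_max_of_lt_left (Nat.pos_of_ne_zero (by
    rintro h; rw [h] at huu; omega))
  set a₂ : ℝ := Real.log ((max u v : ℕ) : ℝ) / Real.log p with ha₂def
  set a₁ : ℝ := Real.log (2 * ((max u v : ℕ) : ℝ)) / Real.log p with ha₁def
  have ha₁ : Real.log ((2 * max u' v' : ℕ) : ℝ) ≤ a₁ * Real.log p := by
    rw [ha₁def, div_mul_cancel₀ _ hLp0.ne']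
    apply Real.log_le_log (by positivity)
    push_cast
    have : max (u' : ℝ) (v' : ℝ) ≤ max (u : ℝ) (v : ℝ) := by exact_mod_cast hmax
    linarith
  have ha₂ : Real.log ((max u' v' : ℕ) : ℝ) ≤ a₂ * Real.log p := by
    rw [ha₂def, div_mul_cancel₀ _ hLp0.ne']
    exact Real.log_le_log (by positivity) (by exact_mod_cast hmax)
  have hB := soloInformed_theoremB_of_theoremA hA hp hp2 hu'odd hv'odd hu'v' hcop hpu' hpv' u₂ uy
    hu₂ huy hg ha₁ ha₂
  -- max{x, 250} + 4 ≤ x + 254 for x ≥ 0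
  have hx0 : 0 ≤ 100 * ((orderOf (2 : ZMod p) : ℝ) * a₁ * a₂) := by
    have h3 : 1 ≤ max u v := le_max_of_le_left hu0
    have : 0 ≤ a₁ := div_nonneg (Real.log_nonneg (by
      have : (1 : ℝ) ≤ ((max u v : ℕ) : ℝ) := by exact_mod_cast h3
      linarith)) hLp0.le
    have : 0 ≤ a₂ := div_nonneg (Real.log_nonneg (by exact_mod_cast h3)) hLp0.le
    positivity
  have hmaxle : max (100 * ((orderOf (2 : ZMod p) : ℝ) * a₁ * a₂)) 250 + 4
      ≤ 100 * ((orderOf (2 : ZMod p) : ℝ) * a₁ * a₂) + 254 := by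
    rcases le_total (100 * ((orderOf (2 : ZMod p) : ℝ) * a₁ * a₂)) 250 with h | h
    · rw [max_eq_right h]; linarith
    · rw [max_eq_left h]; linarith
  have heq : 100 * ((orderOf (2 : ZMod p) : ℝ) * a₁ * a₂) + 254
      = 100 * orderOf (2 : ZMod p) * Real.log ((max u v : ℕ) : ℝ)
          * Real.log (2 * ((max u v : ℕ) : ℝ)) / (Real.log p) ^ 2 + 254 := by
    rw [ha₁def, ha₂def]; field_simp
  linarith [hB, hmaxle, heq.le]


/-- **Theorem C from Theorem A** (report §2.3): for distinct odd primes `q_j ≠ p` with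
`2^m · ord_p 2 > p - 1`, `W(p) ≤ 100·ord_p(2)·log Q·log 2Q/(log p)² + 254`, `Q = ∏ q_j`. -/
theorem soloInformed_theoremC_of_theoremA {p : ℕ} (hp : p.Prime) (hp2 : p ≠ 2) {m : ℕ}
    (q : Fin m → ℕ) (hqprime : ∀ j, (q j).Prime) (hq2 : ∀ j, q j ≠ 2) (hqp : ∀ j, q j ≠ p)
    (hqinj : Function.Injective q) (hcard : p - 1 < 2 ^ m * orderOf (2 : ZMod p)) :
    (padicValNat p (2 ^ (p - 1) - 1) : ℝ) ≤
      100 * orderOf (2 : ZMod p) * Real.log ((∏ j, q j : ℕ) : ℝ)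
        * Real.log (2 * ((∏ j, q j : ℕ) : ℝ)) / (Real.log p) ^ 2 + 254 :=
  soloInformed_wieferichExp_le_of_subgroupTwoLogBound (by norm_num)
    (soloInformed_subgroupTwoLogBound_of_theoremA hA) hp hp2 q hqprime hq2 hqp hqinj hcard

/-- **Corollary D from Theorem A** (report §2.3): the one-prime abc prediction (F5) at every odd
prime of index `i_p` with `(log i_p)^4 ≤ δ log p`. -/
theorem soloInformed_corollaryD_of_theoremA {ε : ℝ} (hε : 0 < ε) :
    ∃ δ : ℝ, 0 < δ ∧ ∃ K : ℝ, ∀ p : ℕ, p.Prime → p ≠ 2 →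
      Real.log (((p : ℝ) - 1) / (orderOf (2 : ZMod p) : ℝ)) ^ 4 ≤ δ * Real.log p →
      (padicValNat p (2 ^ (p - 1) - 1) : ℝ) * Real.log p
        ≤ ε * (orderOf (2 : ZMod p) : ℝ) * Real.log 2 + K :=
  soloInformed_onePrime_growingIndex_of_subgroupTwoLogBound (by norm_num) (by norm_num)
    (soloInformed_subgroupTwoLogBound_of_theoremA hA) hε

end TheoremA

end Summit.ABC.ABC.Theorems
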